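import Summits.AnomalousDissipation.AnomalousDissipation.Theorems.CubicParityLoud.Negative.LoadBearing

/-!
# Negative knowledge for the crux `MomentParity.CubicParityLoud` (stmt-AnomalousDissipation-11465), IV:
# anatomy of a witness — floors

Certified copy of §6–§7 of the cdisprove work file `Cruxes/CubicParityLoud/Disproof.lean`
(refuter-cdisprove-stmt-AnomalousDissipation-11465-0, cycle 1). Supports stmt-AnomalousDissipation-11465;
nothing here closes an item. Quantitative necessary conditions every witness of the crux satisfies:

* §6 energy floor `ε ≤ ‖f‖₂ √(ensembleEnergy μ)`, average-speed floor `ε ≤ ‖f‖₂ ∫‖u‖dμ`, and the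
  TAYLOR-SHELL CHARGE `ε − 4π²m²νE ≤ ν ∫ tail_m(u) dμ` for every cut-off `m` (half of the dissipation lives
  at wavenumbers `≳ ν^{-1/2}`), from the low/high enstrophy splitting `‖∇v‖² ≤ 4π²m²∫‖v‖² + tail_m(v)`.
* §7 MOMENTUM FLOOR from the LINEAR rows alone: `(f, g) ≤ ν‖Δg‖₂ ∫‖u‖dμ + ‖∇g‖_∞ ∫‖u‖²dμ` for every
  level-`N` band test `g` (`IsStationary3.linear_row`, `force_pairing_le_of_linear_row`,
  `IsWitness.force_pairing_le`); with `g = P_N f` the energy budget is bounded below independently of `ε`,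
  `E ≥ (‖f‖₂² − o(1))/sup|∇f|` — every 2-stationary level-`N` statistics held against `f` at small `ν` is
  macroscopic (its Reynolds stresses balance `f`).
-/

noncomputable section

namespace Summit.AnomalousDissipation.AnomalousDissipation.Theorems.CubicParityLoud.Negative

open MeasureTheory Filter UnitAddTorus
open scoped InnerProductSpace RealInnerProductSpace ENNReal
open Literature.Analysis.FunctionSpaces Literature.Analysis.FluidPDE
open Summit.AnomalousDissipation.AnomalousDissipation.Theses.MomentParity

/-! ## §6 ANATOMY OF A WITNESS (quantitative necessary conditions any construction must meet)

* energy floor `ε ≤ ‖f‖₂ √(ensembleEnergy μ)`;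
* AVERAGE-SPEED FLOOR `ε ≤ ‖f‖₂ ∫‖u‖dμ` (the sharper MEAN-FLOW FLOOR `‖f‖₂‖ū_N‖₂ ≥ ε` is §8);
* TAYLOR-SHELL CHARGE: for every cut-off `m`, the enstrophy beyond `|k| > m` carries dissipation
  `≥ ε − 4π²m²νE`; with `m² = ε/(8π²νE)` at least half of `ε` sits at wavenumbers `≳ ν^{-1/2}`. -/

section Anatomy

/-- **ENERGY FLOOR**: `ε ≤ ‖f‖₂ √(ensembleEnergy μ)`, i.e. `ensembleEnergy μ ≥ (ε/‖f‖₂)²`. -/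
theorem IsWitness.le_power_energy {f : T3 → R3} (hf : MemLp f 2 volume) {ν : ℝ} {N : ℕ} {E ε : ℝ}
    {μ : Measure H3} (hW : IsWitness f ν N E ε μ) :
    ε ≤ Real.sqrt (∫ x, ‖f x‖ ^ 2) * Real.sqrt (Torus.ensembleEnergy μ) := by
  have hP := hW.1
  have h2 : Integrable (fun u : H3 => ‖u‖ ^ 2) μ := integrable_norm_pow_of_cube hW.2.2.1 (p := 2) (by norm_num)
  calc ε ≤ ∫ u, Torus.pairing u.1 f ∂μ := hW.integral_pairing_ge hf
    _ ≤ _ := integral_pairing_le hf h2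

/-- **AVERAGE-SPEED FLOOR**: `ε ≤ ‖f‖₂ ∫ ‖u‖ dμ` — the law charges fields of macroscopic size.
(The sharper MEAN-FLOW floor `ε ≤ ‖f‖₂ ‖ū‖`, `ū = Σ_a (∫(u,e_a)dμ) e_a` the level-`N` mean flow, holds by
the same energy row, `∫ (u,f) dμ = (ū, f)`; recorded here in the weaker Bochner-free form.) -/
theorem IsWitness.le_integral_norm {f : T3 → R3} (hf : MemLp f 2 volume) {ν : ℝ} {N : ℕ} {E ε : ℝ}
    {μ : Measure H3} (hW : IsWitness f ν N E ε μ) :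
    ε ≤ Real.sqrt (∫ x, ‖f x‖ ^ 2) * ∫ u, ‖u‖ ∂μ := by
  have hP := hW.1
  have h1 : Integrable (fun u : H3 => ‖u‖) μ := by
    simpa using integrable_norm_pow_of_cube hW.2.2.1 (p := 1) (by norm_num)
  have hstep : ∫ u, Torus.pairing u.1 f ∂μ ≤ ∫ u, ‖u‖ * ‖hf.toLp f‖ ∂μ :=
    integral_mono (integrable_pairing hf h1) (h1.mul_const _) fun u =>
      (le_abs_self _).trans (Torus.abs_pairing_coe_le hf u)
  rw [integral_mul_const] at hstep
  calc ε ≤ ∫ u, Torus.pairing u.1 f ∂μ := hW.integral_pairing_ge hf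
    _ ≤ (∫ u, ‖u‖ ∂μ) * ‖hf.toLp f‖ := hstep
    _ = Real.sqrt (∫ x, ‖f x‖ ^ 2) * ∫ u, ‖u‖ ∂μ := by rw [norm_toLp_eq_sqrt, mul_comm]

/-- **Low/high splitting of the enstrophy**: `‖∇v‖² ≤ 4π²m² ∫‖v‖² + tail_m(v)` for an `L²` field
(Bernstein on the ball of radius `m`, the rest is the tail enstrophy `Torus.tailGradNormSq`). -/
theorem eGradNormSq_le_low_add_tail {v : T3 → R3} (hv : MemLp v 2 volume) (m : ℕ) :
    Torus.eGradNormSq v ≤ ENNReal.ofReal (4 * Real.pi ^ 2 * (m : ℝ) ^ 2 * ∫ x, ‖v x‖ ^ 2) +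
      Torus.tailGradNormSq m v := by
  set gC : T3 → EuclideanSpace ℂ (Fin 3) := EuclideanSpace.complexify ∘ v with hgC
  set g : (Fin 3 → ℤ) → ℝ≥0∞ := fun k => ENNReal.ofReal (Torus.freqNormSq k) * ‖mFourierCoeff gC k‖ₑ ^ 2 with hg
  have hpar := Torus.hasSum_sq_norm_mFourierCoeff_complexify hv
  have hsplit := (ENNReal.sum_add_tsum_compl (Torus.freqBall m) g).symm
  have hlow : ∑ k ∈ Torus.freqBall m, g k ≤ ENNReal.ofReal ((m : ℝ) ^ 2) * ∑' k, ‖mFourierCoeff gC k‖ₑ ^ 2 := by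
    calc ∑ k ∈ Torus.freqBall m, g k
        ≤ ∑ k ∈ Torus.freqBall m, ENNReal.ofReal ((m : ℝ) ^ 2) * ‖mFourierCoeff gC k‖ₑ ^ 2 := by
          refine Finset.sum_le_sum fun k hk => ?_
          change ENNReal.ofReal (Torus.freqNormSq k) * ‖mFourierCoeff gC k‖ₑ ^ 2 ≤ _
          gcongr
          exact Torus.mem_freqBall.1 hk
      _ = ENNReal.ofReal ((m : ℝ) ^ 2) * ∑ k ∈ Torus.freqBall m, ‖mFourierCoeff gC k‖ₑ ^ 2 := by
          rw [Finset.mul_sum]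
      _ ≤ ENNReal.ofReal ((m : ℝ) ^ 2) * ∑' k, ‖mFourierCoeff gC k‖ₑ ^ 2 := by
          gcongr
          exact ENNReal.sum_le_tsum _
  have htsum : ∑' k, ‖mFourierCoeff gC k‖ₑ ^ 2 = ENNReal.ofReal (∫ x, ‖v x‖ ^ 2) := by
    have h1 : ∀ k, ‖mFourierCoeff gC k‖ₑ ^ 2 = ENNReal.ofReal (‖mFourierCoeff gC k‖ ^ 2) := fun k => by
      rw [← ofReal_norm, ENNReal.ofReal_pow (norm_nonneg _)]
    simp_rw [h1]
    rw [← ENNReal.ofReal_tsum_of_nonneg (fun k => sq_nonneg _) hpar.summable, hpar.tsum_eq]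
  rw [Torus.eGradNormSq_eq_tsum]
  change ENNReal.ofReal (4 * Real.pi ^ 2) * ∑' k, g k ≤ _
  rw [hsplit, mul_add]
  refine add_le_add ?_ (le_of_eq rfl)
  calc ENNReal.ofReal (4 * Real.pi ^ 2) * ∑ k ∈ Torus.freqBall m, g k
      ≤ ENNReal.ofReal (4 * Real.pi ^ 2) * (ENNReal.ofReal ((m : ℝ) ^ 2) * ∑' k, ‖mFourierCoeff gC k‖ₑ ^ 2) := by
        gcongr
    _ = ENNReal.ofReal (4 * Real.pi ^ 2 * (m : ℝ) ^ 2 * ∫ x, ‖v x‖ ^ 2) := by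
        rw [htsum, ← ENNReal.ofReal_mul (by positivity), ← ENNReal.ofReal_mul (by positivity)]
        congr 1; ring

/-- The mean enstrophy of a witness is finite (else `ensembleDissipation = ν · 0 < ε`). -/
theorem IsWitness.ensembleEnstrophy_ne_top {f : T3 → R3} {ν : ℝ} {N : ℕ} {E ε : ℝ} (hε : 0 < ε)
    {μ : Measure H3} (hW : IsWitness f ν N E ε μ) : Torus.ensembleEnstrophy μ ≠ ⊤ := by
  intro htop
  have h := hW.2.2.2.2.2
  rw [Torus.ensembleDissipation, htop, ENNReal.toReal_top, mul_zero] at h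
  exact absurd h (not_le.2 hε)

/-- **TAYLOR-SHELL CHARGE**: for every cut-off `m`, the enstrophy of a witness beyond the ball of radius
`m` dissipates at least `ε − 4π²m²νE`: `ε − 4π²m²νE ≤ ν ∫ tail_m(u) dμ`. With `m² ≤ ε/(8π²νE)` the tail
carries `≥ ε/2` — witnesses charge wavenumbers `≳ ν^{-1/2}` with half of the dissipation. -/
theorem IsWitness.tail_dissipation_ge {f : T3 → R3} {ν : ℝ} (hν : 0 ≤ ν) {N : ℕ} {E ε : ℝ} (hε : 0 < ε)
    {μ : Measure H3} (hW : IsWitness f ν N E ε μ) (m : ℕ) :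
    ε - 4 * Real.pi ^ 2 * (m : ℝ) ^ 2 * ν * E ≤
      ν * (∫⁻ u, Torus.tailGradNormSq m ((u : L2T3) : T3 → R3) ∂μ).toReal := by
  have hfin : Torus.ensembleEnstrophy μ ≠ ⊤ := hW.ensembleEnstrophy_ne_top hε
  obtain ⟨hP, hlev, h3, -, hE, hεle⟩ := hW
  have h2 : Integrable (fun u : H3 => ‖u‖ ^ 2) μ := integrable_norm_pow_of_cube h3 (p := 2) (by norm_num)
  set c : ℝ := 4 * Real.pi ^ 2 * (m : ℝ) ^ 2 with hc
  have hc0 : 0 ≤ c := by positivity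
  -- pointwise splitting, integrated
  have hsplit : ∫⁻ u, Torus.eGradNormSq ((u : L2T3) : T3 → R3) ∂μ ≤
      ∫⁻ u, ENNReal.ofReal (c * ‖u‖ ^ 2) ∂μ + ∫⁻ u, Torus.tailGradNormSq m ((u : L2T3) : T3 → R3) ∂μ := by
    rw [← lintegral_add_left' (by
      exact (ENNReal.measurable_ofReal.comp (measurable_const.mul (continuous_norm.measurable.pow_const 2))).aemeasurable)]
    refine lintegral_mono fun u => ?_
    have := eGradNormSq_le_low_add_tail (Lp.memLp (u : L2T3)) m
    rwa [Torus.integral_norm_sq_coe_eq, ← hc] at this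
  have hlow : ∫⁻ u, ENNReal.ofReal (c * ‖u‖ ^ 2) ∂μ = ENNReal.ofReal (c * Torus.ensembleEnergy μ) := by
    rw [Torus.ensembleEnergy, ← integral_const_mul]
    exact (ofReal_integral_eq_lintegral_ofReal (h2.const_mul c) (ae_of_all _ fun u => by positivity)).symm
  have htail_fin : ∫⁻ u, Torus.tailGradNormSq m ((u : L2T3) : T3 → R3) ∂μ ≠ ⊤ :=
    ne_top_of_le_ne_top hfin (lintegral_mono fun u => Torus.tailGradNormSq_le m _)
  -- pass to reals
  have hreal : (Torus.ensembleEnstrophy μ).toReal ≤ c * Torus.ensembleEnergy μ +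
      (∫⁻ u, Torus.tailGradNormSq m ((u : L2T3) : T3 → R3) ∂μ).toReal := by
    have hEn : 0 ≤ c * Torus.ensembleEnergy μ := mul_nonneg hc0 (integral_nonneg fun _ => by positivity)
    have := ENNReal.toReal_mono (ENNReal.add_ne_top.2 ⟨ENNReal.ofReal_ne_top, htail_fin⟩) (hsplit.trans_eq (by rw [hlow]))
    rwa [ENNReal.toReal_add ENNReal.ofReal_ne_top htail_fin, ENNReal.toReal_ofReal hEn] at this
  have hdis : ε ≤ ν * (Torus.ensembleEnstrophy μ).toReal := hεle
  have hE' : c * ν * Torus.ensembleEnergy μ ≤ c * ν * E := mul_le_mul_of_nonneg_left hE (by positivity)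
  nlinarith [mul_le_mul_of_nonneg_left hreal hν]

end Anatomy


/-! ## §7 MOMENTUM FLOOR: the LINEAR rows alone force a macroscopic energy budget, whatever `ε`

The degree-1 tests `p(u) = (u, g)` give the mean momentum balance `(f,g) + ν∫(u,Δg)dμ + ∫∫(u⊗u):∇g dμ = 0`
for every level-`N` band test `g`: the force is balanced by mean viscous stress plus the divergence of the
Reynolds stress. Hence `(f, g) ≤ ν‖Δg‖₂ ∫‖u‖dμ + ‖∇g‖_∞ ∫‖u‖²dμ`; for a witness (energy `≤ E`):
`(f, g) ≤ ν‖Δg‖₂√E + ‖∇g‖_∞ E`. With `g = P_N f` (`(f, P_N f) = ‖P_N f‖₂²`, `‖∇P_N f‖_∞ ≤ truncDerivBound`)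
this is an ENERGY FLOOR INDEPENDENT OF `ε`: `E ≥ (‖f‖₂² − o(1)) / sup|∇f|` as `ν → 0` — every 2-stationary
level-`N` statistics held against `f` at small viscosity is macroscopic (no "small loud" witnesses, and no
small quiet ones either). -/

section MomentumFloor

/-- The differential of the linear observable `p(u) = (u, g)` is `g` itself. -/
theorem polyGrad_X (g : T3 → R3) (u : H3) :
    polyGrad (fun _ : Fin 1 => g) (MvPolynomial.X 0) u = g := by
  funext x
  simp [polyGrad, MvPolynomial.pderiv_X]

/-- **LINEAR ROW extraction**: every level-`N` band test `g` has an integrable, mean-zero generator row. -/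
theorem IsStationary3.linear_row {ν : ℝ} {f : T3 → R3} {N : ℕ} {μ : Measure H3}
    (hstat : IsStationary3 ν f N μ) {g : T3 → R3} (hg : IsBandTest N g) :
    Integrable (fun u => Torus.nsGeneratorPairing ν f u g) μ ∧
      ∫ u, Torus.nsGeneratorPairing ν f u g ∂μ = 0 := by
  have h := hstat 1 (fun _ => g) (MvPolynomial.X 0) (fun _ => hg)
    (by rw [MvPolynomial.totalDegree_X]; norm_num)
  simp only [polyGrad_X] at h
  exact h

/-- The inertial pairing against a test with derivative bound `K` is bounded by `K ‖u‖²`. -/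
theorem abs_inertialPairing_le {g : T3 → R3} {K : ℝ} (hK : ∀ x a, ‖Torus.fderiv g x a‖ ≤ K * ‖a‖)
    (u : H3) : |Torus.inertialPairing (u : L2T3) g| ≤ K * ‖u‖ ^ 2 := by
  rw [Torus.inertialPairing]
  have hmem : MemLp ((u : L2T3) : T3 → R3) 2 volume := Lp.memLp _
  have hint2 : Integrable (fun x => ‖((u : L2T3) : T3 → R3) x‖ ^ 2) volume :=
    hmem.integrable_norm_pow two_ne_zero
  calc |∫ x, ⟪Torus.fderiv g x (((u : L2T3) : T3 → R3) x), ((u : L2T3) : T3 → R3) x⟫_ℝ|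
      ≤ ∫ x, |⟪Torus.fderiv g x (((u : L2T3) : T3 → R3) x), ((u : L2T3) : T3 → R3) x⟫_ℝ| :=
        abs_integral_le_integral_abs
    _ ≤ ∫ x, K * ‖((u : L2T3) : T3 → R3) x‖ ^ 2 := by
        refine integral_mono_of_nonneg (ae_of_all _ fun _ => abs_nonneg _) (hint2.const_mul K)
          (ae_of_all _ fun x => ?_)
        calc |⟪Torus.fderiv g x (((u : L2T3) : T3 → R3) x), ((u : L2T3) : T3 → R3) x⟫_ℝ|
            ≤ ‖Torus.fderiv g x (((u : L2T3) : T3 → R3) x)‖ * ‖((u : L2T3) : T3 → R3) x‖ :=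
              abs_real_inner_le_norm _ _
          _ ≤ (K * ‖((u : L2T3) : T3 → R3) x‖) * ‖((u : L2T3) : T3 → R3) x‖ :=
              mul_le_mul_of_nonneg_right (hK x _) (norm_nonneg _)
          _ = K * ‖((u : L2T3) : T3 → R3) x‖ ^ 2 := by ring
    _ = K * ‖u‖ ^ 2 := by rw [integral_const_mul, Torus.integral_norm_sq_coe_eq]; rfl

/-- The Stokes term of the linear row is bounded by `‖u‖ ‖Δg‖₂`. -/
theorem abs_stokes_le {g : T3 → R3} (hg : Torus.IsSmooth g) (u : H3) :
    |∫ x, ⟪((u : L2T3) : T3 → R3) x, Torus.laplacian g x⟫_ℝ| ≤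
      ‖u‖ * Real.sqrt (∫ x, ‖Torus.laplacian g x‖ ^ 2) := by
  have hΔ : MemLp (Torus.laplacian g) 2 volume := hg.laplacian.memLp 2
  have h := Torus.abs_pairing_coe_le hΔ u
  rw [norm_toLp_eq_sqrt hΔ] at h
  exact h

/-- **MOMENTUM FLOOR (row form)**: if the linear row of a smooth test `g` with derivative bound `K`
holds (integrable, mean zero) for a probability law with integrable energy, then
`(f, g) ≤ ν ‖Δg‖₂ ∫‖u‖ dμ + K ∫‖u‖² dμ`. -/
theorem force_pairing_le_of_linear_row {ν : ℝ} (hν : 0 ≤ ν) {f g : T3 → R3} (hg : Torus.IsSmooth g)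
    {K : ℝ} (hK : ∀ x a, ‖Torus.fderiv g x a‖ ≤ K * ‖a‖)
    {μ : Measure H3} [IsProbabilityMeasure μ] (h2 : Integrable (fun u : H3 => ‖u‖ ^ 2) μ)
    (hrowI : Integrable (fun u => Torus.nsGeneratorPairing ν f u g) μ)
    (hrow0 : ∫ u, Torus.nsGeneratorPairing ν f u g ∂μ = 0) :
    ∫ x, ⟪f x, g x⟫_ℝ ≤
      ν * Real.sqrt (∫ x, ‖Torus.laplacian g x‖ ^ 2) * (∫ u, ‖u‖ ∂μ) + K * ∫ u, ‖u‖ ^ 2 ∂μ := by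
  set A : ℝ := ∫ x, ⟪f x, g x⟫_ℝ with hA
  set B : H3 → ℝ := fun u => ∫ x, ⟪((u : L2T3) : T3 → R3) x, Torus.laplacian g x⟫_ℝ with hB
  set I : H3 → ℝ := fun u => Torus.inertialPairing (u : L2T3) g with hI
  set C : ℝ := Real.sqrt (∫ x, ‖Torus.laplacian g x‖ ^ 2) with hC
  have hΔ : MemLp (Torus.laplacian g) 2 volume := hg.laplacian.memLp 2
  have h1 : Integrable (fun u : H3 => ‖u‖) μ := by
    refine Integrable.mono' ((integrable_const (1 : ℝ)).add h2)
      continuous_norm.aestronglyMeasurable (ae_of_all _ fun u => ?_)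
    rw [Real.norm_eq_abs, abs_of_nonneg (norm_nonneg _), Pi.add_apply]
    nlinarith [norm_nonneg u, sq_nonneg (‖u‖ - 1)]
  have hgen : ∀ u : H3, Torus.nsGeneratorPairing ν f u g = A + ν * B u + I u := fun u => rfl
  have hBint : Integrable B μ := integrable_pairing hΔ h1
  have hIint : Integrable I μ := by
    have := hrowI.sub ((integrable_const A).add (hBint.const_mul ν))
    refine this.congr (ae_of_all _ fun u => ?_)
    simp only [Pi.sub_apply, Pi.add_apply, hgen]
    ring
  have hrow : A + ν * (∫ u, B u ∂μ) + ∫ u, I u ∂μ = 0 := by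
    have h := hrow0
    simp_rw [hgen] at h
    have hAB : Integrable (fun u : H3 => A + ν * B u) μ := (integrable_const A).add (hBint.const_mul ν)
    rw [integral_add hAB hIint, integral_add (integrable_const A) (hBint.const_mul ν), integral_const_mul,
      integral_const] at h
    simpa [probReal_univ] using h
  have hBabs : |∫ u, B u ∂μ| ≤ C * ∫ u, ‖u‖ ∂μ := by
    calc |∫ u, B u ∂μ| ≤ ∫ u, |B u| ∂μ := abs_integral_le_integral_abs
      _ ≤ ∫ u, ‖u‖ * C ∂μ := integral_mono hBint.abs (h1.mul_const C) fun u => abs_stokes_le hg u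
      _ = C * ∫ u, ‖u‖ ∂μ := by rw [integral_mul_const, mul_comm]
  have hIabs : |∫ u, I u ∂μ| ≤ K * ∫ u, ‖u‖ ^ 2 ∂μ := by
    calc |∫ u, I u ∂μ| ≤ ∫ u, |I u| ∂μ := abs_integral_le_integral_abs
      _ ≤ ∫ u, K * ‖u‖ ^ 2 ∂μ := integral_mono hIint.abs (h2.const_mul K) fun u => abs_inertialPairing_le hK u
      _ = K * ∫ u, ‖u‖ ^ 2 ∂μ := integral_const_mul _ _
  have hAeq : A = -(ν * ∫ u, B u ∂μ) - ∫ u, I u ∂μ := by linarith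
  rw [hAeq]
  have hb1 : -(ν * ∫ u, B u ∂μ) ≤ ν * (C * ∫ u, ‖u‖ ∂μ) := by
    have : -(∫ u, B u ∂μ) ≤ C * ∫ u, ‖u‖ ∂μ := (neg_le_abs _).trans hBabs
    nlinarith
  have hb2 : -(∫ u, I u ∂μ) ≤ K * ∫ u, ‖u‖ ^ 2 ∂μ := (neg_le_abs _).trans hIabs
  linarith

/-- **MOMENTUM FLOOR FOR WITNESSES**: for every level-`N` band test `g` with derivative bound `K`,
`(f, g) ≤ ν ‖Δg‖₂ √E + K E`. With `g = P_N f`: `‖P_N f‖₂² ≤ ν‖ΔP_N f‖₂√E + ‖∇P_N f‖_∞ E` — the energy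
budget of any witness (indeed of any 2-stationary level-`N` law forced by `f`) is bounded below
INDEPENDENTLY OF `ε`: `E ≥ (‖f‖₂² − o(1))/sup|∇f|` as `ν → 0`. -/
theorem IsWitness.force_pairing_le {f : T3 → R3} {ν : ℝ} (hν : 0 ≤ ν) {N : ℕ} {E ε : ℝ} {μ : Measure H3}
    (hW : IsWitness f ν N E ε μ) {g : T3 → R3} (hg : IsBandTest N g)
    {K : ℝ} (hK0 : 0 ≤ K) (hK : ∀ x a, ‖Torus.fderiv g x a‖ ≤ K * ‖a‖) :
    ∫ x, ⟪f x, g x⟫_ℝ ≤ ν * Real.sqrt (∫ x, ‖Torus.laplacian g x‖ ^ 2) * Real.sqrt E + K * E := by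
  obtain ⟨hP, hlev, h3, hstat, hE, -⟩ := hW
  have h2 : Integrable (fun u : H3 => ‖u‖ ^ 2) μ := integrable_norm_pow_of_cube h3 (p := 2) (by norm_num)
  obtain ⟨hI, h0⟩ := hstat.linear_row hg
  have hmain := force_pairing_le_of_linear_row hν hg.1 hK h2 hI h0
  have hE' : ∫ u, ‖u‖ ^ 2 ∂μ ≤ E := hE
  have h1le : ∫ u, ‖u‖ ∂μ ≤ Real.sqrt E :=
    ((le_abs_self _).trans (Real.abs_le_sqrt (sq_integral_norm_le h2))).trans (Real.sqrt_le_sqrt hE')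
  have hC0 : 0 ≤ ν * Real.sqrt (∫ x, ‖Torus.laplacian g x‖ ^ 2) := mul_nonneg hν (Real.sqrt_nonneg _)
  calc ∫ x, ⟪f x, g x⟫_ℝ
      ≤ ν * Real.sqrt (∫ x, ‖Torus.laplacian g x‖ ^ 2) * (∫ u, ‖u‖ ∂μ) + K * ∫ u, ‖u‖ ^ 2 ∂μ := hmain
    _ ≤ ν * Real.sqrt (∫ x, ‖Torus.laplacian g x‖ ^ 2) * Real.sqrt E + K * E := by
        gcongr

/-- The truncation `P_N v` has derivative bound `truncDerivBound N v` (for use with `g = P_N f`). -/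
theorem fderiv_fourierTruncate_bound (N : ℕ) (v : T3 → R3) (x : T3) (a : R3) :
    ‖Torus.fderiv (Torus.fourierTruncate N v) x a‖ ≤ Torus.truncDerivBound N v * ‖a‖ := by
  rw [mul_comm]; exact Torus.norm_fderiv_fourierTruncate_apply_le N v x a

end MomentumFloor


end Summit.AnomalousDissipation.AnomalousDissipation.Theorems.CubicParityLoud.Negative
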